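/-
Copyright (c) 2026 the pub-hodgecm-mathlib formalisation cell (harness21).  Prover seat hodgecm-mathlib-K2E1-p14 (g4), Track B ∕ K2-LIT, h413 = `stmt-HodgeConjecture-24833`,
R90-TF section S8 «ContSpec-n½», ESTATE T (S8-R208 (1) «(α) MULTIPLICITY-ONE LINE for τ-slices by the type-free Gelfand route»; census
`K2/K2E1-p14/g4/CENSUS-E6-KTypeSliceLine.K2E1-p14-g4.md`, dealer «=» S8-R210 (1)): §1 THE ONLY NEW MATHEMATICS — in `K_v = {k ∈ U(3) | k J₃ = J₃ k} ≅ U(2) × U(1)` every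
element is conjugate to its TRANSPOSE by an element of the torus `M_v = {diag(u, β, u)}`; §2–§3 the ★ Literature Gelfand-pair theorems `commute_orbitalOp_of_antiHom` ∕
`exists_forall_homSpace_eq_smul_of_commute_orbitalOp` READ WITH `(G, K) := (K_v, M_v)` (hypothesis-first over a unitary realisation `j : Kv →* U(3)`).
-/
import Literature.RepresentationTheory.CompactGroups.KTypeMultiplicityOneOfCommutingOrbital
import Mathlib.LinearAlgebra.UnitaryGroup
import Mathlib.LinearAlgebra.Matrix.Notation
import Mathlib.Analysis.Complex.Basic
import HarnessLib

/-!
# S8 ESTATE T (α) — `R90S8KTypeSliceLineU3`: TRANSPOSE-CONJUGACY IN `K_v ≅ U(2) × U(1)` BY ITS TORUS `M_v` — the `hconj` input of the Gelfand pair `(K_v × M_v, ΔM_v)` that makes every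
# character of `M_v` occur in every irreducible `K_v`-type with multiplicity ≤ 1 (the τ-slice LINE of the E1 estate T)

Track B ∕ K2-LIT, crux h413 = `stmt-HodgeConjecture-24833`, route of record `HCCMUnconditional`; cell `hodgecm-mathlib`, R90-TF programme, section S8 «ContSpec-n½», ESTATE T
(K-finite Eisenstein exports; LEAD ruling J-S8-T2, S8-R208): the τ-ports of ★ 12d-I ∕ 12d-C ∕ P1 ∕ 7b-1 need «the `(B_∞, c_z; K_∞, τ)`-slices form a LINE», i.e. multiplicity ≤ 1 of the
Borel character `σ` of `M_v = B_∞ ∩ K_v` in every irreducible `K_v`-type `τ` (Frobenius).  THEOREMS ONLY (no `def`, no `instance`, no `notation`, no named-fact hypothesis, no `sorry`;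
default heartbeats); lane `--supports stmt-HodgeConjecture-24833 --as helper` (count-neutral).  CLOSES NO SOCKET.

THE ROUTE (type-free, no `K̂`, no highest weights).  ★ `Literature/RepresentationTheory/CompactGroups/GelfandTrickOrbitalOperators` `commute_orbitalOp_of_antiHom`: for a compact `K →* G`,
an anti-homomorphism `σ` of `G`, a Haar-preserving `θ : K ≃ₜ* K` with `σ(ι k) = (ι(θ k))⁻¹` and **`hconj : ∀ z : G, ∃ u : K, σ z = ι u · z · (ι u)⁻¹`**, the orbital operators
`O_x = ∫_K π(ιk·x·ιk⁻¹) dk` commute; ★ `KTypeMultiplicityOneOfCommutingOrbital` `exists_forall_homSpace_eq_smul_of_commute_orbitalOp`: then `Hom_K(τ, π∘ι)` is a LINE for `π` irreducible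
unitary and `τ` finite-dimensional irreducible unitary.  READ WITH `(G, K) := (K_v, M_v)`, `σ :=` transpose on `K_v`, `θ :=` inversion on the abelian `M_v` (`mᵀ = m = (m⁻¹)⁻¹`), `π := τ` an
irreducible `K_v`-type, «τ» `:=` a unitary character of `M_v`: the conclusion is «every character of `M_v` occurs in `τ|_{M_v}` with multiplicity ≤ 1» — p11's census item (3) without a weight
computation.  THE ONLY NEW INPUT is `hconj` for `(K_v, M_v)`, proved here in antidiagonal coordinates (`J₃ = antidiag(1,1,1)`, Mok's frame of record): `k J₃ = J₃ k` forces the shape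
`k = [[a, b, c], [d, e, d], [c, b, a]]`; unitarity of `k` (row `0` and column `0` have norm `1`, and `k₂₀ = k₀₂`) gives `|b| = |d|`; and `m = diag(u, β, u)` satisfies `kᵀ m = m k` iff
`u b = β d` — take `(u, β) = (d∕b, 1)` if `b ≠ 0`, `(1, 1)` if `b = d = 0`.  [Helgason2000 IV §3 (Gelfand's trick); Knapp1986 VIII §3; DeitmarEchterhoff2014 §7.3]
* §1 **`exists_torus_mul_eq_transpose_mul`** — for `k ∈ U(3)` commuting with `J₃`: `∃ u β, |u| = |β| = 1 ∧ kᵀ · diag(u, β, u) = diag(u, β, u) · k`.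
* §2 (hypothesis-first over an abstract topological group `Kv` with an injective `j : Kv →* U(3)` commuting with `J₃`, a compact abelian `Mv` with `ι : Mv →* Kv` onto the torus, `σ` =
  transpose read through `j`): `antiHom_of_transpose_realisation`, `transpose_apply_torus_eq`, **`exists_torus_conj_eq_transpose`** (`hconj`), **`commute_orbitalOp_torus_of_transpose_realisation`**
  (the orbital operators `∫_{M_v} π(ι m · x · ι m⁻¹) dμ` of any unitary `K_v`-representation commute; `θ :=` inversion, Haar-preserving by `μ.IsInvInvariant`).
* §3 **`exists_forall_homSpace_torus_eq_smul_of_transpose_realisation`** — the multiplicity-≤-1 LINE `∃ S₀ : Hom_{M_v}(τ, π|_{M_v}), ∀ S, ∃ c, S = c • S₀` for `π` an irreducible `K_v`-type and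
  `τ` a finite-dimensional irreducible unitary `M_v`-representation (every character): one `exact` of the ★ Literature theorem.
HONEST LABEL: HC_CM is proved only modulo the 7 printed citations (2 remaining named inputs: hLiu418 = `stmt-HodgeConjecture-24832`, h413 = `stmt-HodgeConjecture-24833`) until
rung 0 closes; REL ≠ ★ ≠ BUILT; this file asserts no named fact and closes no socket; count-neutral; unconditional.

## References
* [Helgason2000] S. Helgason, *Groups and Geometric Analysis* (AMS 2000), Ch. IV §3, Thm. 3.1 (Gelfand's trick with an anti-automorphism).
* [Knapp1986] A. W. Knapp, *Representation Theory of Semisimple Groups* (1986), VIII §3 (K-types of principal series; Frobenius reciprocity).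
* [DeitmarEchterhoff2014] A. Deitmar, S. Echterhoff, *Principles of Harmonic Analysis* (2nd ed., 2014), §7.3, Lemma 7.3.1.
* [Rogawski1990] J. D. Rogawski, *Automorphic Representations of Unitary Groups in Three Variables* (1990), §12.3 (K-types of `U(2,1)(ℝ)`).
-/

set_option autoImplicit false
set_option linter.dupNamespace false  -- the mandated namespace `…HodgeConjecture.HodgeConjecture.R90.S8` (LEAD #1 L1) repeats the summit's segment

noncomputable section

open Matrix MeasureTheory ContRepresentation Literature.RepresentationTheory.CompactGroups
open scoped ComplexConjugate InnerProductSpace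

namespace Summit.HodgeConjecture.HodgeConjecture.R90.S8

/-! ## §1 `hconj` for `(K_v, M_v)`: every `k ∈ U(3)` commuting with `J₃` is conjugate to `kᵀ` by a torus element `diag(u, β, u)` -/

/-- **TRANSPOSE-CONJUGACY IN `K_v = {k ∈ U(3) | k J₃ = J₃ k} ≅ U(2) × U(1)` BY THE TORUS `M_v = {diag(u, β, u)}`** (the `hconj` letter of ★ `commute_orbitalOp_of_antiHom` for the Gelfand pair
`(K_v × M_v, ΔM_v)`): for `k ∈ U(3)` with `k J₃ = J₃ k` (`J₃ = antidiag(1,1,1)`) there are `u, β` of modulus `1` with `kᵀ · diag(u, β, u) = diag(u, β, u) · k`.  Proof: `kJ₃ = J₃k` gives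
`k₀₀ = k₂₂, k₀₁ = k₂₁, k₀₂ = k₂₀, k₁₀ = k₁₂`; unit row `0` and unit column `0` give `|k₀₁| = |k₁₀|`; the identity reduces to `u k₀₁ = β k₁₀`: take `(k₁₀∕k₀₁, 1)`, or `(1, 1)` when `k₀₁ = k₁₀ = 0`.
[cite: Helgason2000, Ch. IV §3 Thm. 3.1] [cite: Knapp1986, VIII §3] -/
theorem exists_torus_mul_eq_transpose_mul (k : Matrix (Fin 3) (Fin 3) ℂ) (hk : k ∈ Matrix.unitaryGroup (Fin 3) ℂ)
    (hJ : k * !![(0 : ℂ), 0, 1; 0, 1, 0; 1, 0, 0] = !![(0 : ℂ), 0, 1; 0, 1, 0; 1, 0, 0] * k) :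
    ∃ u β : ℂ, ‖u‖ = 1 ∧ ‖β‖ = 1 ∧ kᵀ * Matrix.diagonal ![u, β, u] = Matrix.diagonal ![u, β, u] * k := by
  -- the symmetry relations forced by `k J₃ = J₃ k`
  have hrel : ∀ i j : Fin 3, (k * !![(0 : ℂ), 0, 1; 0, 1, 0; 1, 0, 0]) i j = (!![(0 : ℂ), 0, 1; 0, 1, 0; 1, 0, 0] * k) i j :=
    fun i j => by rw [hJ]
  have h00 : k 0 0 = k 2 2 := by have h := hrel 0 2; simp [Matrix.mul_apply, Fin.sum_univ_three] at h; exact h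
  have h01 : k 0 1 = k 2 1 := by have h := hrel 0 1; simp [Matrix.mul_apply, Fin.sum_univ_three] at h; exact h
  have h02 : k 0 2 = k 2 0 := by have h := hrel 0 0; simp [Matrix.mul_apply, Fin.sum_univ_three] at h; exact h
  have h10 : k 1 0 = k 1 2 := by have h := hrel 1 2; simp [Matrix.mul_apply, Fin.sum_univ_three] at h; exact h
  -- `|k 0 1| = |k 1 0|` from the unit row 0 and the unit column 0
  have hrow := Matrix.mem_unitaryGroup_iff.1 hk   -- k * star k = 1
  have hcol := Matrix.mem_unitaryGroup_iff'.1 hk  -- star k * k = 1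
  have hr0 : k 0 0 * conj (k 0 0) + k 0 1 * conj (k 0 1) + k 0 2 * conj (k 0 2) = 1 := by
    have h := congrFun (congrFun hrow 0) 0
    simpa [Matrix.mul_apply, Fin.sum_univ_three, Matrix.star_apply] using h
  have hc0 : conj (k 0 0) * k 0 0 + conj (k 1 0) * k 1 0 + conj (k 2 0) * k 2 0 = 1 := by
    have h := congrFun (congrFun hcol 0) 0
    simpa [Matrix.mul_apply, Fin.sum_univ_three, Matrix.star_apply] using h
  have hnorm : Complex.normSq (k 0 1) = Complex.normSq (k 1 0) := by
    have e1 : (Complex.normSq (k 0 0) : ℂ) + Complex.normSq (k 0 1) + Complex.normSq (k 0 2) = 1 := by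
      rw [Complex.normSq_eq_conj_mul_self, Complex.normSq_eq_conj_mul_self, Complex.normSq_eq_conj_mul_self]
      simpa [mul_comm] using hr0
    have e2 : (Complex.normSq (k 0 0) : ℂ) + Complex.normSq (k 1 0) + Complex.normSq (k 0 2) = 1 := by
      rw [Complex.normSq_eq_conj_mul_self, Complex.normSq_eq_conj_mul_self, Complex.normSq_eq_conj_mul_self, h02]
      simpa using hc0
    have e3 : (Complex.normSq (k 0 1) : ℂ) = Complex.normSq (k 1 0) := by linear_combination e1 - e2
    exact_mod_cast e3
  by_cases hb : k 0 1 = 0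
  · -- then `k 1 0 = 0` too, and the torus element is `1`
    have hd : k 1 0 = 0 := by
      rw [hb, map_zero] at hnorm
      exact Complex.normSq_eq_zero.1 hnorm.symm
    refine ⟨1, 1, by simp, by simp, ?_⟩
    ext i j
    fin_cases i <;> fin_cases j <;> simp [Matrix.transpose_apply, ← h00, ← h01, ← h02, ← h10, hb, hd]
  · -- `u := k 1 0 ∕ k 0 1`, `β := 1`
    refine ⟨k 1 0 / k 0 1, 1, ?_, by simp, ?_⟩
    · rw [norm_div]
      have h1 : ‖k 0 1‖ = ‖k 1 0‖ := by
        rw [Complex.norm_def, Complex.norm_def, hnorm]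
      rw [← h1, div_self (norm_ne_zero_iff.2 hb)]
    · ext i j
      fin_cases i <;> fin_cases j <;> simp [Matrix.transpose_apply, ← h00, ← h01, ← h02, ← h10] <;> field_simp


/-! ## §2 The Gelfand pair `(K_v × M_v, ΔM_v)`: ★ `commute_orbitalOp_of_antiHom` READ WITH `(G, K) := (K_v, M_v)`, `σ := transpose`, `θ := inversion`

Hypothesis-first over an abstract topological group `Kv` REALISED in `U(3)` by an injective hom `j` with `j(Kv)` commuting with `J₃` (the compact `K_v` of record at an archimedean
place, in Mok's antidiagonal frame), a compact abelian `Mv` with continuous `ι : Mv →* Kv` whose image IS the torus `{diag(u, β, u)}` (`hjι`: `⊆`; `hjM`: `⊇`), a transpose `σ` on `Kv` read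
through `j` (`hσj`), and a two-sided, inversion-invariant Haar probability `μ` on `Mv`.  The consumer (the E1 estate T, per place `v ∣ ∞`) instantiates `Kv, Mv, ι, j, σ` from the
archimedean dictionary of record; nothing here names `U(2,1)`. -/

section GelfandPair

variable {Kv : Type*} [Group Kv] {Mv : Type*} [CommGroup Mv]

/-- A map `σ` on `Kv` which is TRANSPOSITION in an injective unitary realisation `j : Kv →* U(3)` is an anti-homomorphism: `σ(ab) = σ(b)σ(a)` (`(AB)ᵀ = BᵀAᵀ`).
[cite: Helgason2000, Ch. IV §3 Thm. 3.1] -/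
theorem antiHom_of_transpose_realisation (j : Kv →* Matrix.unitaryGroup (Fin 3) ℂ) (hj : Function.Injective j) {σ : Kv → Kv}
    (hσj : ∀ k : Kv, ((j (σ k) : Matrix.unitaryGroup (Fin 3) ℂ) : Matrix (Fin 3) (Fin 3) ℂ) = ((j k : Matrix.unitaryGroup (Fin 3) ℂ) : Matrix (Fin 3) (Fin 3) ℂ)ᵀ)
    (a b : Kv) : σ (a * b) = σ b * σ a :=
  hj (Subtype.ext (by rw [hσj, map_mul, map_mul, Matrix.UnitaryGroup.mul_val, Matrix.UnitaryGroup.mul_val, Matrix.transpose_mul, hσj, hσj]))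

/-- The transpose FIXES the torus: `σ (ι m) = ι m` for `m : Mv`, since `j (ι m) = diag(u, β, u)` is symmetric. [cite: Helgason2000, Ch. IV §3 Thm. 3.1] -/
theorem transpose_apply_torus_eq (ι : Mv →* Kv) (j : Kv →* Matrix.unitaryGroup (Fin 3) ℂ) (hj : Function.Injective j) {σ : Kv → Kv}
    (hσj : ∀ k : Kv, ((j (σ k) : Matrix.unitaryGroup (Fin 3) ℂ) : Matrix (Fin 3) (Fin 3) ℂ) = ((j k : Matrix.unitaryGroup (Fin 3) ℂ) : Matrix (Fin 3) (Fin 3) ℂ)ᵀ)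
    (hjι : ∀ m : Mv, ∃ u β : ℂ, ((j (ι m) : Matrix.unitaryGroup (Fin 3) ℂ) : Matrix (Fin 3) (Fin 3) ℂ) = Matrix.diagonal ![u, β, u]) (m : Mv) :
    σ (ι m) = ι m := by
  obtain ⟨u, β, h⟩ := hjι m
  exact hj (Subtype.ext (by rw [hσj, h, Matrix.diagonal_transpose]))

/-- **`hconj` for `(K_v, M_v)`** (§1 transported through the realisation): every `z : Kv` satisfies `σ z = ι u · z · (ι u)⁻¹` for some torus element `u : Mv` — from ★ §1
`exists_torus_mul_eq_transpose_mul` at `j z` and the surjectivity `hjM` of `j ∘ ι` onto `{diag(u, β, u) : |u| = |β| = 1}`. [cite: Helgason2000, Ch. IV §3 Thm. 3.1] [cite: Knapp1986, VIII §3] -/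
theorem exists_torus_conj_eq_transpose (ι : Mv →* Kv) (j : Kv →* Matrix.unitaryGroup (Fin 3) ℂ) (hj : Function.Injective j)
    (hjJ : ∀ k : Kv, ((j k : Matrix.unitaryGroup (Fin 3) ℂ) : Matrix (Fin 3) (Fin 3) ℂ) * !![(0 : ℂ), 0, 1; 0, 1, 0; 1, 0, 0] =
      !![(0 : ℂ), 0, 1; 0, 1, 0; 1, 0, 0] * ((j k : Matrix.unitaryGroup (Fin 3) ℂ) : Matrix (Fin 3) (Fin 3) ℂ))
    (hjM : ∀ u β : ℂ, ‖u‖ = 1 → ‖β‖ = 1 → ∃ m : Mv, ((j (ι m) : Matrix.unitaryGroup (Fin 3) ℂ) : Matrix (Fin 3) (Fin 3) ℂ) = Matrix.diagonal ![u, β, u])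
    {σ : Kv → Kv}
    (hσj : ∀ k : Kv, ((j (σ k) : Matrix.unitaryGroup (Fin 3) ℂ) : Matrix (Fin 3) (Fin 3) ℂ) = ((j k : Matrix.unitaryGroup (Fin 3) ℂ) : Matrix (Fin 3) (Fin 3) ℂ)ᵀ)
    (z : Kv) : ∃ u : Mv, σ z = ι u * z * (ι u)⁻¹ := by
  obtain ⟨u, β, hu, hβ, hcomm⟩ := exists_torus_mul_eq_transpose_mul ((j z : Matrix.unitaryGroup (Fin 3) ℂ) : Matrix (Fin 3) (Fin 3) ℂ) (j z).2 (hjJ z)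
  obtain ⟨m, hm⟩ := hjM u β hu hβ
  have h1 : σ z * ι m = ι m * z :=
    hj (Subtype.ext (by rw [map_mul, map_mul, Matrix.UnitaryGroup.mul_val, Matrix.UnitaryGroup.mul_val, hσj, hm]; exact hcomm))
  exact ⟨m, eq_mul_inv_of_mul_eq h1⟩

variable [TopologicalSpace Kv] [IsTopologicalGroup Kv]
variable [TopologicalSpace Mv] [IsTopologicalGroup Mv] [CompactSpace Mv] [MeasurableSpace Mv] [BorelSpace Mv] [SecondCountableTopology Mv]
variable {X : Type*} [NormedAddCommGroup X] [InnerProductSpace ℂ X] [CompleteSpace X]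

/-- **THE ORBITAL OPERATORS OF A `K_v`-TYPE OVER THE TORUS `M_v` COMMUTE** (★ `commute_orbitalOp_of_antiHom` READ WITH `(G, K) := (K_v, M_v)`): for a unitary strongly continuous
representation `π` of `Kv` on a Hilbert space, the operators `O_x = ∫_{M_v} π(ι m · x · ι m⁻¹) dμ(m)` pairwise commute — Gelfand's trick with `σ :=` transpose (an anti-homomorphism by
`antiHom_of_transpose_realisation`, fixing the torus by `transpose_apply_torus_eq`), `θ :=` inversion on the abelian `Mv` (Haar-preserving by inversion invariance, and `σ(ι m) = ι m =
(ι (m⁻¹))⁻¹`), and `hconj :=` `exists_torus_conj_eq_transpose`. [cite: Helgason2000, Ch. IV §3 Thm. 3.1] [cite: DeitmarEchterhoff2014, Lemma 7.3.1] -/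
theorem commute_orbitalOp_torus_of_transpose_realisation (μ : Measure Mv) [IsProbabilityMeasure μ] [μ.IsMulLeftInvariant]
    [μ.IsMulRightInvariant] [μ.IsInvInvariant] (ι : Mv →* Kv) (hι : Continuous ι)
    (j : Kv →* Matrix.unitaryGroup (Fin 3) ℂ) (hj : Function.Injective j)
    (hjJ : ∀ k : Kv, ((j k : Matrix.unitaryGroup (Fin 3) ℂ) : Matrix (Fin 3) (Fin 3) ℂ) * !![(0 : ℂ), 0, 1; 0, 1, 0; 1, 0, 0] =
      !![(0 : ℂ), 0, 1; 0, 1, 0; 1, 0, 0] * ((j k : Matrix.unitaryGroup (Fin 3) ℂ) : Matrix (Fin 3) (Fin 3) ℂ))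
    (hjι : ∀ m : Mv, ∃ u β : ℂ, ((j (ι m) : Matrix.unitaryGroup (Fin 3) ℂ) : Matrix (Fin 3) (Fin 3) ℂ) = Matrix.diagonal ![u, β, u])
    (hjM : ∀ u β : ℂ, ‖u‖ = 1 → ‖β‖ = 1 → ∃ m : Mv, ((j (ι m) : Matrix.unitaryGroup (Fin 3) ℂ) : Matrix (Fin 3) (Fin 3) ℂ) = Matrix.diagonal ![u, β, u])
    (σ : Kv → Kv)
    (hσj : ∀ k : Kv, ((j (σ k) : Matrix.unitaryGroup (Fin 3) ℂ) : Matrix (Fin 3) (Fin 3) ℂ) = ((j k : Matrix.unitaryGroup (Fin 3) ℂ) : Matrix (Fin 3) (Fin 3) ℂ)ᵀ)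
    (π : ContRepresentation ℂ Kv X) (hπ : π.IsStronglyContinuous) (hU : π.IsUnitary) (x y : Kv) :
    Commute (orbitalOp μ ι π hι hπ hU x) (orbitalOp μ ι π hι hπ hU y) := by
  let θ : Mv ≃ₜ* Mv := { MulEquiv.inv Mv with continuous_toFun := continuous_inv, continuous_invFun := continuous_inv }
  have hθ : MeasurePreserving θ μ μ := Measure.measurePreserving_inv μ
  have hσι : ∀ m : Mv, σ (ι m) = (ι (θ m))⁻¹ := fun m => by
    rw [transpose_apply_torus_eq ι j hj hσj hjι m]
    show ι m = (ι m⁻¹)⁻¹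
    rw [map_inv, inv_inv]
  exact commute_orbitalOp_of_antiHom (antiHom_of_transpose_realisation j hj hσj) θ hθ hσι (exists_torus_conj_eq_transpose ι j hj hjJ hjM hσj) x y

/-! ## §3 The multiplicity-≤-1 LINE: every irreducible unitary representation of `M_v` (in particular every unitary character) occurs in every irreducible `K_v`-type at most ONCE -/

/-- **MULTIPLICITY ONE OF `M_v`-TYPES IN `K_v`-TYPES — the τ-slice LINE** (★ `exists_forall_homSpace_eq_smul_of_commute_orbitalOp` READ WITH `(G, K) := (K_v, M_v)`): for `π` an irreducible
unitary strongly continuous representation of `Kv` (a `K_v`-type) and `τ` a finite-dimensional irreducible unitary representation of the torus `Mv` (a character `σ` of `M_v = B_∞ ∩ K_v`), the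
multiplicity space `Hom_{M_v}(τ, π|_{M_v})` is AT MOST A LINE: `∃ S₀, ∀ S, ∃ c, S = c • S₀`.  For a character on `W = ℂ` the map `S ↦ S.toCLM 1` identifies it with the `σ`-weight space
`{v | ∀ m, π(ι m) v = σ(m) v}` of `π`, so every character of `M_v` has multiplicity ≤ 1 in every `K_v`-type — by Frobenius reciprocity the `τ`-valued `(B_∞, c_z; K_∞, τ)`-slices of the
induced representation form a LINE (the port step of the E1 estate T, p11's census item (3)), with NO weight computation. [cite: Helgason2000, Ch. IV §3 Thm. 3.1] [cite: Knapp1986, VIII §3]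
[cite: DeitmarEchterhoff2014, Lemma 7.3.1] [cite: Rogawski1990, §12.3] -/
theorem exists_forall_homSpace_torus_eq_smul_of_transpose_realisation (μ : Measure Mv) [IsProbabilityMeasure μ] [μ.IsMulLeftInvariant]
    [μ.IsMulRightInvariant] [μ.IsInvInvariant] (ι : Mv →* Kv) (hι : Continuous ι)
    (j : Kv →* Matrix.unitaryGroup (Fin 3) ℂ) (hj : Function.Injective j)
    (hjJ : ∀ k : Kv, ((j k : Matrix.unitaryGroup (Fin 3) ℂ) : Matrix (Fin 3) (Fin 3) ℂ) * !![(0 : ℂ), 0, 1; 0, 1, 0; 1, 0, 0] =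
      !![(0 : ℂ), 0, 1; 0, 1, 0; 1, 0, 0] * ((j k : Matrix.unitaryGroup (Fin 3) ℂ) : Matrix (Fin 3) (Fin 3) ℂ))
    (hjι : ∀ m : Mv, ∃ u β : ℂ, ((j (ι m) : Matrix.unitaryGroup (Fin 3) ℂ) : Matrix (Fin 3) (Fin 3) ℂ) = Matrix.diagonal ![u, β, u])
    (hjM : ∀ u β : ℂ, ‖u‖ = 1 → ‖β‖ = 1 → ∃ m : Mv, ((j (ι m) : Matrix.unitaryGroup (Fin 3) ℂ) : Matrix (Fin 3) (Fin 3) ℂ) = Matrix.diagonal ![u, β, u])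
    (σ : Kv → Kv)
    (hσj : ∀ k : Kv, ((j (σ k) : Matrix.unitaryGroup (Fin 3) ℂ) : Matrix (Fin 3) (Fin 3) ℂ) = ((j k : Matrix.unitaryGroup (Fin 3) ℂ) : Matrix (Fin 3) (Fin 3) ℂ)ᵀ)
    (π : ContRepresentation ℂ Kv X) (hπ : π.IsStronglyContinuous) (hU : π.IsUnitary) (hirr : π.IsTopIrreducible)
    {W : Type*} [NormedAddCommGroup W] [InnerProductSpace ℂ W] [FiniteDimensional ℂ W] (τ : ContRepresentation ℂ Mv W)
    (hτu : ∀ (m : Mv) (v w : W), ⟪τ m v, τ m w⟫_ℂ = ⟪v, w⟫_ℂ) [τ.toRepresentation.IsIrreducible] :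
    ∃ S₀ : HomSpace τ (π.restrict ι), ∀ S : HomSpace τ (π.restrict ι), ∃ c : ℂ, S = c • S₀ :=
  exists_forall_homSpace_eq_smul_of_commute_orbitalOp hirr
    (commute_orbitalOp_torus_of_transpose_realisation μ ι hι j hj hjJ hjι hjM σ hσj π hπ hU) hτu

end GelfandPair

end Summit.HodgeConjecture.HodgeConjecture.R90.S8

end
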